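import Literature.NumberTheory.GaloisRepresentations.CompletionValuedGaloisNorm
import Literature.NumberTheory.GaloisRepresentations.SpectralNormGaloisNorm
import Literature.NumberTheory.GaloisRepresentations.CompletionCompositumEmbedding
import Literature.NumberTheory.GaloisRepresentations.SemiLocalUnitGroupPlaceSummands
import Literature.NumberTheory.Automorphic.AdicCompletionLocalField
import HarnessLib

/-!
# The compositum isomorphisms `ψ : K_v(E) ≅ E_w` carry the unit ball onto `𝒪_{E_w}`, the units onto `𝒪_{E_w}^×` and the principal
# units onto `U¹_w`: `‖y‖ ≤ 1 ⟺ v_w(ψ y) ≤ 1`, `‖y‖ < 1 ⟺ v_w(ψ y) < 1`, `‖y − 1‖ < 1 ⟺ v_w(ψ y − 1) < 1`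
# (Cassels–Fröhlich II §10 "`L_w = K_v L`"; Serre *Local Fields* II §2)

Topic `NumberTheory/GaloisRepresentations`; namespace `Literature.NumberTheory.GaloisRepresentations.SemiLocal`.  For a finite Galois
extension of number fields `E/K` (in `Type`), a finite place `v` of `K`, a `K`-embedding `ιE : E → K̄` and a place `w ∣ v`, the tree has the
compositum `compositum ιE v = K_v(ι_v ιE E) ⊆ K̄_v` (`CompletionCompositum`, `SemiLocalCompositumBridge`) and `K_v`-algebra isomorphisms
`ψ : compositum ιE v ≃ₐ[K_v] E_w` (`compositumAlgEquivPlace ιE w` for every `w ∣ v`; the distinguished `compositumEquivEmb v ιE` at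
`w_v = embPlace v ιE`, `CompletionCompositumEmbedding`).  The two sides carry DIFFERENT valuation currencies: `K_v(E) ⊆ K̄_v` is normed by the
SPECTRAL NORM of the Lubin–Tate / Coleman files (local instances `ltNormUniformSpace`, `rk1`, `nF`, `nE`; unit ball `LubinTate.unitBall`,
principal units `‖u − 1‖ < 1` as in `principalCoherentFamilies`), while `E_w` carries Mathlib's `ℤᵐ⁰`-valued `Valued.v`
(`adicCompletionIntegers`, `ValuationSubring.unitGroup` / `principalUnitGroup`, Rubin's place model `SemiLocal.principalUnitGroup`).
THIS file is the bridge (memo BRICK-C-ORBITS-g22 F39/F42, dictionary item D2 «local model», part LM2(c)), for ANY such `ψ`: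

* §1 ★★ `spectralNorm_le_one_iff_valued_le_one` (`‖y‖ ≤ 1 ⟺ v_w(ψ y) ≤ 1`), ★★ `spectralNorm_lt_one_iff_valued_lt_one`,
  ★★ `spectralNorm_eq_one_iff_valued_eq_one`, ★★ `spectralNorm_sub_one_lt_one_iff` (`‖y − 1‖ < 1 ⟺ v_w(ψ y − 1) < 1`), and the
  `ψ.symm` forms.  Proof (route (β) of F39, no integral closures): `‖y‖ ≤ 1 ⟺ v(N_{K_v(E)/K_v} y) ≤ 1` (spectral side,
  `SpectralNormGaloisNorm`), `v_w(z) ≤ 1 ⟺ v_v(N_{E_w/K_v} z) ≤ 1` (completion side, `CompletionValuedGaloisNorm`), `N(ψ y) = N(y)`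
  (Mathlib `Algebra.norm_eq_of_algEquiv`), and on `K_v` the two valuations — the `ValuativeRel` one behind the local norm `nF` and Mathlib's
  `Valued.v` — define the same `≤ᵥ` (`Valuation.vle_one_iff` / `vlt_one_iff` for two compatible valuations, `AdicCompletionLocalField`).
* §2 memberships: `mem_unitBall_iff_mem_adicCompletionIntegers` (`y ∈ 𝒪_{K_v(E)} ⟺ ψ y ∈ 𝒪_{E_w}`), `…_symm`,
  `valued_eq_one_and_valued_sub_one_lt_one_iff` (units / principal units), and ★★ `unitBallEquivAdicCompletionIntegers ψ :
  unitBall (compositum ιE v) ≃+* 𝒪_{E_w}` (the restriction of `ψ`; `_apply`/`_symm_apply` coercion lemmas), with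
  `norm_eq_one_iff_isUnit`-type readings `spectralNorm_eq_one_iff_valued_unitBallEquiv_eq_one`.
* §3 the distinguished instance: `finiteDimensional_compositum_of_place` (use through `haveI`), and the §1 statements for
  `compositumEquivEmb v ιE` on GLOBAL elements: `valued_embPlace_le_one_iff` (`v_{w_v}(e) ≤ 1 ⟺ ‖ι_v ιE e‖ ≤ 1` in `K_v(E)`).

Use (cell `bsd-print-cf2`, brick §4(c)/(e)): with `CompletionCompositumTower.algHom_compositum_norm` (the `ψ` carry local norms to
`towerAlgebra`-norms) this lets the norm-coherent principal units `lim← U¹((F_n)_{w_n})` of a tower of number fields be read as norm-coherent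
families of principal units of the embedded local layers `K_v(F_n) ⊆ K̄_v` — the currency of `RelNormCoherentUnits` / `principalCoherentFamilies`.
One definition (`unitBallEquivAdicCompletionIntegers`, the restriction of `ψ`), theorems otherwise; no named fact, no instance, no `sorry`;
the normed structures are the Lubin–Tate files' LOCAL instances.

## References
* [CasselsFrohlichANT1967] J. W. S. Cassels, A. Fröhlich (eds.), *Algebraic Number Theory* (1967), Ch. II (Cassels) §10 Theorem and "`L_w = K_v L`",
  §11; Ch. VII (Tate) §1.1.
* [SerreLocalFields1979] J.-P. Serre, *Local Fields* (1979), Ch. II §2 Cor. 4 (`w(x) = (1/f) v(N_{L/K} x)`: integrality through the norm).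
-/

noncomputable section

open NumberField IsDedekindDomain IntermediateField Field
open scoped Valued

namespace Literature.NumberTheory.GaloisRepresentations

namespace SemiLocal

open Literature.NumberTheory.Automorphic GaloisRepresentations.IsNonarchimedeanLocalField LubinTate ValuativeRel

attribute [local instance] ltNormUniformSpace ltNormIsUniformAddGroup rk1 nF nE fintypeResidueField

variable {K : Type} [Field K] [NumberField K] {E : Type} [Field E] [NumberField E] [Algebra K E] [IsGalois K E]
  {v : HeightOneSpectrum (𝓞 K)} (ιE : E →ₐ[K] AlgebraicClosure K) {w : Place K E v}

/-! ### §0. The two valuations of `K_v` define the same integers and the same maximal ideal -/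

/-- On `K_v`, `valuation K_v c ≤ 1 ⟺ Valued.v c ≤ 1`: the `ValuativeRel` valuation (behind the Lubin–Tate files' local norm) and Mathlib's
`ℤᵐ⁰`-valued valuation are both compatible with `≤ᵥ`. [cite: SerreLocalFields1979, Ch. II §1] -/
theorem valuation_le_one_iff_valued_le_one (c : v.adicCompletion K) :
    valuation (v.adicCompletion K) c ≤ 1 ↔ (Valued.v c : WithZero (Multiplicative ℤ)) ≤ 1 := by
  rw [← Valuation.vle_one_iff (valuation (v.adicCompletion K)),
    Valuation.vle_one_iff (Valued.v : Valuation (v.adicCompletion K) (WithZero (Multiplicative ℤ)))]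

/-- On `K_v`, `valuation K_v c < 1 ⟺ Valued.v c < 1`. [cite: SerreLocalFields1979, Ch. II §1] -/
theorem valuation_lt_one_iff_valued_lt_one (c : v.adicCompletion K) :
    valuation (v.adicCompletion K) c < 1 ↔ (Valued.v c : WithZero (Multiplicative ℤ)) < 1 := by
  rw [← Valuation.vlt_one_iff (valuation (v.adicCompletion K)),
    Valuation.vlt_one_iff (Valued.v : Valuation (v.adicCompletion K) (WithZero (Multiplicative ℤ)))]

/-! ### §1. `‖y‖ ≤ 1 ⟺ v_w(ψ y) ≤ 1`, `‖y‖ < 1 ⟺ v_w(ψ y) < 1`, `‖y‖ = 1 ⟺ v_w(ψ y) = 1`, principal units -/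

variable [FiniteDimensional (v.adicCompletion K) (compositum ιE v)]
  (ψ : compositum ιE v ≃ₐ[v.adicCompletion K] (w : HeightOneSpectrum (𝓞 E)).adicCompletion E)

/-- ★★ **`‖y‖ ≤ 1 ⟺ v_w(ψ y) ≤ 1`** for every `K_v`-algebra isomorphism `ψ : K_v(E) ≅ E_w` (`‖·‖` the spectral norm on `K_v(E) ⊆ K̄_v`):
integrality on both sides is decided by the norm down to `K_v`, and `N(ψ y) = N(y)`.
[cite: SerreLocalFields1979, Ch. II §2 Cor. 4] [cite: CasselsFrohlichANT1967, Ch. II §10] -/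
theorem spectralNorm_le_one_iff_valued_le_one (y : compositum ιE v) : ‖y‖ ≤ 1 ↔ Valued.v (ψ y) ≤ 1 := by
  haveI := isGalois_compositum ιE w
  rw [spectral_norm_le_one_iff_valued_norm_le_one (compositum ιE v) y, valued_le_one_iff_valued_norm_le_one w (ψ y),
    Algebra.norm_eq_of_algEquiv ψ y, ← valuation_le_one_iff_valued_le_one]
  exact Iff.rfl

/-- ★★ **`‖y‖ < 1 ⟺ v_w(ψ y) < 1`** (the maximal ideals correspond). [cite: SerreLocalFields1979, Ch. II §2 Cor. 4] [cite: CasselsFrohlichANT1967, Ch. II §10] -/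
theorem spectralNorm_lt_one_iff_valued_lt_one (y : compositum ιE v) : ‖y‖ < 1 ↔ Valued.v (ψ y) < 1 := by
  haveI := isGalois_compositum ιE w
  rw [spectral_norm_lt_one_iff_valued_norm_lt_one (compositum ιE v) y, valued_lt_one_iff_valued_norm_lt_one w (ψ y),
    Algebra.norm_eq_of_algEquiv ψ y, ← valuation_lt_one_iff_valued_lt_one]
  exact Iff.rfl

/-- ★★ **`‖y‖ = 1 ⟺ v_w(ψ y) = 1`** (the units of the valuation rings correspond). [cite: SerreLocalFields1979, Ch. II §2 Cor. 4] -/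
theorem spectralNorm_eq_one_iff_valued_eq_one (y : compositum ιE v) : ‖y‖ = 1 ↔ Valued.v (ψ y) = 1 := by
  rw [le_antisymm_iff, le_antisymm_iff, spectralNorm_le_one_iff_valued_le_one ιE ψ, and_congr_right_iff]
  intro
  rw [← not_lt, ← not_lt, spectralNorm_lt_one_iff_valued_lt_one ιE ψ]

/-- ★★ **`‖y − 1‖ < 1 ⟺ v_w(ψ y − 1) < 1`**: the principal units `U¹` correspond under `ψ`. [cite: SerreLocalFields1979, Ch. II §2 Cor. 4] -/
theorem spectralNorm_sub_one_lt_one_iff (y : compositum ιE v) : ‖y - 1‖ < 1 ↔ Valued.v (ψ y - 1) < 1 := by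
  rw [spectralNorm_lt_one_iff_valued_lt_one ιE ψ, map_sub, map_one]

/-- `v_w(z) ≤ 1 ⟺ ‖ψ⁻¹ z‖ ≤ 1` (the `ψ.symm` form). [cite: SerreLocalFields1979, Ch. II §2 Cor. 4] -/
theorem valued_le_one_iff_spectralNorm_symm_le_one (z : (w : HeightOneSpectrum (𝓞 E)).adicCompletion E) :
    Valued.v z ≤ 1 ↔ ‖ψ.symm z‖ ≤ 1 := by
  rw [spectralNorm_le_one_iff_valued_le_one ιE ψ, AlgEquiv.apply_symm_apply]

/-- `v_w(z) < 1 ⟺ ‖ψ⁻¹ z‖ < 1`. [cite: SerreLocalFields1979, Ch. II §2 Cor. 4] -/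
theorem valued_lt_one_iff_spectralNorm_symm_lt_one (z : (w : HeightOneSpectrum (𝓞 E)).adicCompletion E) :
    Valued.v z < 1 ↔ ‖ψ.symm z‖ < 1 := by
  rw [spectralNorm_lt_one_iff_valued_lt_one ιE ψ, AlgEquiv.apply_symm_apply]

/-- `v_w(z) = 1 ⟺ ‖ψ⁻¹ z‖ = 1`. [cite: SerreLocalFields1979, Ch. II §2 Cor. 4] -/
theorem valued_eq_one_iff_spectralNorm_symm_eq_one (z : (w : HeightOneSpectrum (𝓞 E)).adicCompletion E) :
    Valued.v z = 1 ↔ ‖ψ.symm z‖ = 1 := by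
  rw [spectralNorm_eq_one_iff_valued_eq_one ιE ψ, AlgEquiv.apply_symm_apply]

/-- `v_w(z − 1) < 1 ⟺ ‖ψ⁻¹ z − 1‖ < 1` (principal units, `ψ.symm` form). [cite: SerreLocalFields1979, Ch. II §2 Cor. 4] -/
theorem valued_sub_one_lt_one_iff_spectralNorm_symm (z : (w : HeightOneSpectrum (𝓞 E)).adicCompletion E) :
    Valued.v (z - 1) < 1 ↔ ‖ψ.symm z - 1‖ < 1 := by
  rw [spectralNorm_sub_one_lt_one_iff ιE ψ, AlgEquiv.apply_symm_apply]

/-! ### §2. Unit balls: `ψ(𝒪_{K_v(E)}) = 𝒪_{E_w}`, units and principal units -/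

/-- `y ∈ 𝒪_{K_v(E)}` (the Lubin–Tate files' `unitBall`) `⟺ ψ y ∈ 𝒪_{E_w}` (`adicCompletionIntegers`). [cite: CasselsFrohlichANT1967, Ch. II §10] -/
theorem mem_unitBall_iff_mem_adicCompletionIntegers (y : compositum ιE v) :
    y ∈ unitBall (compositum ιE v) ↔ ψ y ∈ (w : HeightOneSpectrum (𝓞 E)).adicCompletionIntegers E := by
  rw [mem_unitBall_iff, HeightOneSpectrum.mem_adicCompletionIntegers, spectralNorm_le_one_iff_valued_le_one ιE ψ]

/-- `z ∈ 𝒪_{E_w} ⟺ ψ⁻¹ z ∈ 𝒪_{K_v(E)}`. [cite: CasselsFrohlichANT1967, Ch. II §10] -/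
theorem mem_adicCompletionIntegers_iff_symm_mem_unitBall (z : (w : HeightOneSpectrum (𝓞 E)).adicCompletion E) :
    z ∈ (w : HeightOneSpectrum (𝓞 E)).adicCompletionIntegers E ↔ ψ.symm z ∈ unitBall (compositum ιE v) := by
  rw [mem_unitBall_iff_mem_adicCompletionIntegers ιE ψ, AlgEquiv.apply_symm_apply]

/-- ★★ **`ψ|_{𝒪} : 𝒪_{K_v(E)} ≃+* 𝒪_{E_w}`** — the restriction of `ψ` to the unit ball of the spectral norm is a ring isomorphism onto the
valuation ring of the completion. [cite: CasselsFrohlichANT1967, Ch. II §10] -/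
def unitBallEquivAdicCompletionIntegers :
    unitBall (compositum ιE v) ≃+* (w : HeightOneSpectrum (𝓞 E)).adicCompletionIntegers E where
  toFun y := ⟨ψ (y : compositum ιE v), (mem_unitBall_iff_mem_adicCompletionIntegers ιE ψ (y : compositum ιE v)).mp y.2⟩
  invFun z := ⟨ψ.symm (z : (w : HeightOneSpectrum (𝓞 E)).adicCompletion E),
    (mem_adicCompletionIntegers_iff_symm_mem_unitBall ιE ψ (z : (w : HeightOneSpectrum (𝓞 E)).adicCompletion E)).mp z.2⟩
  left_inv y := Subtype.ext (ψ.symm_apply_apply (y : compositum ιE v))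
  right_inv z := Subtype.ext (ψ.apply_symm_apply (z : (w : HeightOneSpectrum (𝓞 E)).adicCompletion E))
  map_mul' y y' := Subtype.ext (by simp only [Subring.coe_mul, map_mul]; rfl)
  map_add' y y' := Subtype.ext (by simp only [Subring.coe_add, map_add]; rfl)

/-- Coercion: `(ψ|_{𝒪} y : E_w) = ψ y`. [cite: CasselsFrohlichANT1967, Ch. II §10] -/
@[simp] theorem coe_unitBallEquivAdicCompletionIntegers_apply (y : unitBall (compositum ιE v)) :
    ((unitBallEquivAdicCompletionIntegers ιE ψ y : (w : HeightOneSpectrum (𝓞 E)).adicCompletionIntegers E) :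
      (w : HeightOneSpectrum (𝓞 E)).adicCompletion E) = ψ (y : compositum ιE v) := rfl

/-- Coercion: `((ψ|_{𝒪})⁻¹ z : K_v(E)) = ψ⁻¹ z`. [cite: CasselsFrohlichANT1967, Ch. II §10] -/
@[simp] theorem coe_unitBallEquivAdicCompletionIntegers_symm_apply (z : (w : HeightOneSpectrum (𝓞 E)).adicCompletionIntegers E) :
    (((unitBallEquivAdicCompletionIntegers ιE ψ).symm z : unitBall (compositum ιE v)) : compositum ιE v) =
      ψ.symm (z : (w : HeightOneSpectrum (𝓞 E)).adicCompletion E) := rfl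

/-- **Units correspond**: `‖y‖ = 1 ⟺ v_w(ψ|_{𝒪} y) = 1` for `y ∈ 𝒪_{K_v(E)}` (the Lubin–Tate files' `norm_eq_one` of `RelNormCoherentUnits` versus
`Valued.v = 1` on the completion side). [cite: SerreLocalFields1979, Ch. II §2 Cor. 4] -/
theorem norm_coe_eq_one_iff_valued_unitBallEquiv_eq_one (y : unitBall (compositum ιE v)) :
    ‖(y : compositum ιE v)‖ = 1 ↔
      Valued.v ((unitBallEquivAdicCompletionIntegers ιE ψ y : (w : HeightOneSpectrum (𝓞 E)).adicCompletionIntegers E) :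
        (w : HeightOneSpectrum (𝓞 E)).adicCompletion E) = 1 :=
  spectralNorm_eq_one_iff_valued_eq_one ιE ψ y

/-- **Principal units correspond**: `‖y − 1‖ < 1 ⟺ v_w(ψ|_{𝒪} y − 1) < 1` for `y ∈ 𝒪_{K_v(E)}` (the condition of `principalCoherentFamilies` versus
membership in `U¹_w`, `SemiLocal.mem_principalUnitGroup_adicCompletionIntegers_iff`). [cite: SerreLocalFields1979, Ch. II §2 Cor. 4] -/
theorem norm_coe_sub_one_lt_one_iff_valued_unitBallEquiv_sub_one_lt_one (y : unitBall (compositum ιE v)) :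
    ‖(y : compositum ιE v) - 1‖ < 1 ↔
      Valued.v (((unitBallEquivAdicCompletionIntegers ιE ψ y : (w : HeightOneSpectrum (𝓞 E)).adicCompletionIntegers E) :
        (w : HeightOneSpectrum (𝓞 E)).adicCompletion E) - 1) < 1 :=
  spectralNorm_sub_one_lt_one_iff ιE ψ y

/-- **Units as group elements**: for a unit `u` of `E_w`, `u ∈ 𝒪_{E_w}^×` (`ValuationSubring.unitGroup`, i.e. `v_w(u) = 1`) iff `‖ψ⁻¹ u‖ = 1`, and
`u ∈ U¹_w` (`principalUnitGroup`) iff `‖ψ⁻¹ u − 1‖ < 1`. [cite: SerreLocalFields1979, Ch. II §2 Cor. 4] -/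
theorem mem_principalUnitGroup_iff_spectralNorm_symm (u : ((w : HeightOneSpectrum (𝓞 E)).adicCompletion E)ˣ) :
    u ∈ ((w : HeightOneSpectrum (𝓞 E)).adicCompletionIntegers E).principalUnitGroup ↔
      ‖ψ.symm (u : (w : HeightOneSpectrum (𝓞 E)).adicCompletion E) - 1‖ < 1 := by
  rw [mem_principalUnitGroup_adicCompletionIntegers_iff w u, valued_sub_one_lt_one_iff_spectralNorm_symm ιE ψ]

/-- `u ∈ 𝒪_{E_w}^× ⟺ ‖ψ⁻¹ u‖ = 1`. [cite: SerreLocalFields1979, Ch. II §2 Cor. 4] -/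
theorem mem_unitGroup_iff_spectralNorm_symm (u : ((w : HeightOneSpectrum (𝓞 E)).adicCompletion E)ˣ) :
    u ∈ ((w : HeightOneSpectrum (𝓞 E)).adicCompletionIntegers E).unitGroup ↔
      ‖ψ.symm (u : (w : HeightOneSpectrum (𝓞 E)).adicCompletion E)‖ = 1 := by
  rw [ValuationSubring.mem_unitGroup_iff, HeightOneSpectrum.adicCompletionIntegers,
    ← (Valuation.isEquiv_valuation_valuationSubring _).eq_one_iff_eq_one, valued_eq_one_iff_spectralNorm_symm_eq_one ιE ψ]

/-! ### §3. The distinguished isomorphism `compositumEquivEmb v ιE : K_v(E) ≅ E_{w_v}` and GLOBAL elements -/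

omit [FiniteDimensional (v.adicCompletion K) (compositum ιE v)] in
/-- `K_v(E)` is finite over `K_v` (it is `K_v`-isomorphic to a completion; use through `haveI`). [cite: CasselsFrohlichANT1967, Ch. II §10] -/
theorem finiteDimensional_compositum_of_place (w : Place K E v) : FiniteDimensional (v.adicCompletion K) (compositum ιE v) :=
  haveI := finiteDimensional_place (K := K) w
  LinearEquiv.finiteDimensional (compositumAlgEquivPlace ιE w).symm.toLinearEquiv

/-- ★ **GLOBAL elements**: for `e ∈ E`, `v_{w_v}(e) ≤ 1 ⟺ ‖ι_v ιE e‖ ≤ 1` in `K_v(E)` — at the distinguished place `w_v = embPlace v ιE` the image of a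
global element in the completion is integral iff its image in `K̄_v` lies in the unit ball of the spectral norm. [cite: CasselsFrohlichANT1967, Ch. II §10] -/
theorem valued_coe_embPlace_le_one_iff (e : E) :
    Valued.v (algebraMap E (((embPlace v ιE : Place K E v) : HeightOneSpectrum (𝓞 E)).adicCompletion E) e) ≤ 1 ↔
      ‖(⟨(absClosureEmbedding K (v.adicCompletion K)).comp ιE e, mem_compositum v ιE e⟩ : compositum ιE v)‖ ≤ 1 := by
  rw [spectralNorm_le_one_iff_valued_le_one ιE (compositumEquivEmb v ιE), compositumEquivEmb_apply_mk]

/-- ★ GLOBAL elements, principal-unit form: `v_{w_v}(e − 1) < 1 ⟺ ‖ι_v ιE e − 1‖ < 1`. [cite: CasselsFrohlichANT1967, Ch. II §10] -/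
theorem valued_coe_embPlace_sub_one_lt_one_iff (e : E) :
    Valued.v (algebraMap E (((embPlace v ιE : Place K E v) : HeightOneSpectrum (𝓞 E)).adicCompletion E) e - 1) < 1 ↔
      ‖(⟨(absClosureEmbedding K (v.adicCompletion K)).comp ιE e, mem_compositum v ιE e⟩ : compositum ιE v) - 1‖ < 1 := by
  rw [spectralNorm_sub_one_lt_one_iff ιE (compositumEquivEmb v ιE), compositumEquivEmb_apply_mk]

/-- ★ GLOBAL elements, unit form: `v_{w_v}(e) = 1 ⟺ ‖ι_v ιE e‖ = 1`. [cite: CasselsFrohlichANT1967, Ch. II §10] -/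
theorem valued_coe_embPlace_eq_one_iff (e : E) :
    Valued.v (algebraMap E (((embPlace v ιE : Place K E v) : HeightOneSpectrum (𝓞 E)).adicCompletion E) e) = 1 ↔
      ‖(⟨(absClosureEmbedding K (v.adicCompletion K)).comp ιE e, mem_compositum v ιE e⟩ : compositum ιE v)‖ = 1 := by
  rw [spectralNorm_eq_one_iff_valued_eq_one ιE (compositumEquivEmb v ιE), compositumEquivEmb_apply_mk]

end SemiLocal

end Literature.NumberTheory.GaloisRepresentations

end
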